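import Summits.BirchSwinnertonDyer.BirchSwinnertonDyer.Theorems.ResidualThetaTransportAtTwoHeckeThetaPartnerAdicAtTwoThetaQExpansion
import Summits.BirchSwinnertonDyer.BirchSwinnertonDyer.Theorems.ResidualThetaTransportAtTwoHeckeThetaPartnerAdicAtTwoThetaClassCount
import Summits.BirchSwinnertonDyer.BirchSwinnertonDyer.Theorems.ResidualThetaTransportAtTwoHeckeThetaPartnerAdicAtTwoThetaEisenstein
import Literature.NumberTheory.EllipticCurves.HeckeEisensteinWeightOneForm
import Mathlib.NumberTheory.LSeries.Injectivity
import Mathlib.NumberTheory.LSeries.Convolution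
import Mathlib.NumberTheory.LSeries.Nonvanishing
import HarnessLib

/-!
# The multiplier of the theta null of an ideal lattice is the Kronecker character (toward K0⁺, stmt-20690)

Route `ResidualThetaTransportAtTwo`, crux K0⁺ `HeckeThetaPartnerAdicAtTwo` (stmt-BirchSwinnertonDyer-20690),
line "Hecke theta series from the genus-two Riemann theta function".  THEOREMS ONLY.

**`binaryTheta_unit_eq_kronecker`.**  Let `K` be imaginary quadratic, `κ` a Dirichlet character
mod `D = |d_K|` which is primitive, odd, quadratic, `≠ 1`, with `ζ_K(s) = ζ(s) L(s, κ)` (the Kronecker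
character; tree: `QuadraticDedekindZeta*`, `KroneckerCharacterEvenDiscriminant`), `𝔟 ≠ 0` an ideal
with Gram data `(b, B)` (`ThetaGram.exists_gram`), `γ = (a b; c d) ∈ SL₂(ℤ)` with `D ∣ c`, and `Λ` a
unit with `θ_B(γτ) = Λ (cτ + d) θ_B(τ)` on `ℍ` (`BinaryThetaNull`).  Then `Λ = κ(d)` — Hecke 1926 §2
/ Schoeneberg 1939: the theta series of a binary form of discriminant `d_K` is a weight-one form on
`Γ₀(|d_K|)` with character `(d_K/·)`.  PROOF WITHOUT GAUSS SUMS: run `units_eq_of_thetaSum_eisenstein`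
(`ThetaEisenstein`) with the theta nulls of a system of ideal-class representatives (their
`q`-expansions, `ThetaQExpansion`; the class count `Σ_c r_c(n) = w·a_K(n)`, `ThetaClassCount`;
`a_K(n) = Σ_{m∣n} κ(m)` from `ζ_K = ζ·L(κ)`, `idealNormCount_eq_sum_divisors`) against Hecke's
weight-one Eisenstein series `G̃_κ(·,0)` (tree `heckeOne`: law `heckeOne_slash_of_mem_gamma0`,
`q`-expansion `heckeOne_eq_qSeries` with `e(0) = 2L(κ,1) ≠ 0` and `e(n) = -(4πiτ(κ)/D) Σ_{m∣n} κ̄(m)`).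

* `qSeries_norm_sub_one_lt` — a `q`-series with natural coefficients and constant term `1` tends
  to `1` as `Im τ → ∞`, uniformly in `Re τ`;
* `idealNormCount_eq_sum_divisors` — `#{𝔞 : N𝔞 = n} = Σ_{m ∣ n} κ(m)` (`n ≥ 1`);
* `binaryTheta_unit_eq_kronecker` — the theorem above.

BSD is not proved by this file.
-/

set_option autoImplicit false
set_option linter.dupNamespace false

noncomputable section

open scoped NumberField ComplexConjugate Real Topology MatrixGroups UpperHalfPlane nonZeroDivisors
open NumberField Module Matrix Complex Filter CongruenceSubgroup ModularForm

namespace Summit.BirchSwinnertonDyer.BirchSwinnertonDyer.Theorems.HeckeTheta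

open Literature.Analysis.SpecialFunctions
open Literature.NumberTheory.ModularForms.BinaryTheta
open Literature.NumberTheory.Automorphic (siegelUpperHalfSpace mem_siegelUpperHalfSpace_iff)
open Literature.NumberTheory.LFunctions (idealNormCount)
open Literature.NumberTheory.EllipticCurves.ModularForms (heckeOne heckeOneCoeff heckeOne_eq_qSeries
  summable_heckeOneCoeff_mul_pow heckeOne_slash_of_mem_gamma0)

variable {K : Type} [Field K] [NumberField K]

/-! ### `q`-series with natural coefficients tend to their constant term -/

/-- A `q`-series `f(τ) = Σ_n a(n) qⁿ` (`q = e(τ)`) with natural coefficients and `a(0) = 1` satisfies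
`‖f(τ) - 1‖ < ε` for `Im τ` large, uniformly in `Re τ`: `‖f(τ) - 1‖ ≤ C e^{-2π Im τ}` for `Im τ ≥ 1`
with `C = Σ_{n≥1} a(n) e^{-2π(n-1)}`. -/
theorem qSeries_norm_sub_one_lt {f : ℍ → ℂ} {a : ℕ → ℕ} (ha0 : a 0 = 1)
    (hf : ∀ τ : ℍ, HasSum (fun n : ℕ => (a n : ℂ) * cexp (2 * π * Complex.I * (τ : ℂ)) ^ n) (f τ)) :
    ∀ ε > 0, ∃ Y : ℝ, ∀ τ : ℍ, Y ≤ τ.im → ‖f τ - 1‖ < ε := by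
  intro ε hε
  have hqnorm : ∀ τ : ℍ, ‖cexp (2 * π * Complex.I * (τ : ℂ))‖ = Real.exp (-2 * π * τ.im) := by
    intro τ
    rw [Complex.norm_exp]
    congr 1
    simp [Complex.mul_re, UpperHalfPlane.coe_im, UpperHalfPlane.coe_re]
  set q₁ : ℝ := Real.exp (-2 * π) with hq₁
  -- summability at `τ = i`
  have hS1 := hf UpperHalfPlane.I
  have hsumm1 : Summable fun n : ℕ => (a n : ℝ) * q₁ ^ n := by
    refine hS1.summable.norm.congr fun n => ?_
    rw [norm_mul, norm_pow, hqnorm, Complex.norm_natCast, UpperHalfPlane.I_im, mul_one]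
  set C : ℝ := ∑' n : ℕ, (a (n + 1) : ℝ) * q₁ ^ n with hC
  have hq₁pos : 0 < q₁ := Real.exp_pos _
  have hCsum : Summable fun n : ℕ => (a (n + 1) : ℝ) * q₁ ^ n := by
    have h := (summable_nat_add_iff 1).mpr hsumm1
    refine (h.mul_left q₁⁻¹).congr fun n => ?_
    simp only [pow_succ]
    field_simp
  have hC0 : 0 ≤ C := tsum_nonneg fun n => by positivity
  obtain ⟨Y, hY⟩ : ∃ Y : ℝ, ∀ y ≥ Y, C * Real.exp (-2 * π * y) < ε ∧ 1 ≤ y := by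
    have ht : Tendsto (fun y : ℝ => C * Real.exp (-2 * π * y)) atTop (𝓝 0) := by
      have : Tendsto (fun y : ℝ => Real.exp (-2 * π * y)) atTop (𝓝 0) :=
        Real.tendsto_exp_atBot.comp (tendsto_id.const_mul_atTop_of_neg
          (show (-2 * π : ℝ) < 0 by nlinarith [Real.pi_pos]))
      simpa using this.const_mul C
    obtain ⟨Y, hY⟩ := ((ht.eventually (gt_mem_nhds hε)).and (eventually_ge_atTop (1 : ℝ))).exists_forall_of_atTop
    exact ⟨Y, fun y hy => hY y hy⟩
  refine ⟨Y, fun τ hτ => ?_⟩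
  obtain ⟨hlt, hy1⟩ := hY τ.im hτ
  set q : ℂ := cexp (2 * π * Complex.I * (τ : ℂ)) with hqdef
  have hqle : ‖q‖ ≤ q₁ := by
    rw [hqdef, hqnorm, hq₁]
    exact Real.exp_le_exp.mpr (by nlinarith [Real.pi_pos])
  have hS2 : HasSum (fun n : ℕ => (a n : ℂ) * q ^ n) (f τ) := hf τ
  have hS' := (hasSum_nat_add_iff' 1).mpr hS2
  simp only [Finset.range_one, Finset.sum_singleton, pow_zero, mul_one, ha0, Nat.cast_one] at hS'
  have hle : ∀ n : ℕ, ‖(a (n + 1) : ℂ) * q ^ (n + 1)‖ ≤ ((a (n + 1) : ℝ) * q₁ ^ n) * Real.exp (-2 * π * τ.im) := by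
    intro n
    rw [norm_mul, norm_pow, pow_succ, ← mul_assoc, Complex.norm_natCast]
    have hqn : ‖q‖ ^ n ≤ q₁ ^ n := pow_le_pow_left₀ (norm_nonneg _) hqle n
    rw [hqdef, hqnorm] at hqn ⊢
    have : (a (n + 1) : ℝ) * Real.exp (-2 * π * τ.im) ^ n ≤ (a (n + 1) : ℝ) * q₁ ^ n :=
      mul_le_mul_of_nonneg_left hqn (Nat.cast_nonneg _)
    nlinarith [Real.exp_pos (-2 * π * τ.im), Nat.cast_nonneg (α := ℝ) (a (n + 1))]
  have hsum2 : Summable fun n : ℕ => ((a (n + 1) : ℝ) * q₁ ^ n) * Real.exp (-2 * π * τ.im) :=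
    hCsum.mul_right _
  have hbound : ‖f τ - 1‖ ≤ C * Real.exp (-2 * π * τ.im) := by
    rw [← hS'.tsum_eq]
    calc ‖∑' n : ℕ, (a (n + 1) : ℂ) * q ^ (n + 1)‖
        ≤ ∑' n : ℕ, ‖(a (n + 1) : ℂ) * q ^ (n + 1)‖ := norm_tsum_le_tsum_norm
            (Summable.of_nonneg_of_le (fun n => norm_nonneg _) hle hsum2)
      _ ≤ ∑' n : ℕ, ((a (n + 1) : ℝ) * q₁ ^ n) * Real.exp (-2 * π * τ.im) :=
            Summable.tsum_le_tsum hle (Summable.of_nonneg_of_le (fun n => norm_nonneg _) hle hsum2) hsum2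
      _ = C * Real.exp (-2 * π * τ.im) := by rw [tsum_mul_right]
  exact hbound.trans_lt hlt

/-! ### `a_K(n) = Σ_{m ∣ n} κ(m)` from `ζ_K = ζ · L(κ)` -/

/-- **Coefficient comparison**: if `ζ_K(s) = ζ(s) L(s, κ)` for `Re s > 1` with bounded `κ`, then
`#{𝔞 ⊆ 𝓞_K : N𝔞 = n} = Σ_{m ∣ n} κ(m)` for every `n ≥ 1` (`L`-series injectivity,
`LSeries.eq_of_LSeries_eventually_eq`; Dirichlet convolution `1 ⋆ κ`). -/
theorem idealNormCount_eq_sum_divisors {κ : ℕ → ℂ} (hκ : ∀ n, ‖κ n‖ ≤ 1)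
    (hζ : ∀ s : ℂ, 1 < s.re → NumberField.dedekindZeta K s = riemannZeta s * LSeries κ s)
    {n : ℕ} (hn : n ≠ 0) : (idealNormCount K n : ℂ) = ∑ m ∈ n.divisors, κ m := by
  set f : ℕ → ℂ := fun n => (idealNormCount K n : ℂ) with hfdef
  set g : ℕ → ℂ := LSeries.convolution 1 κ with hgdef
  -- abscissas of absolute convergence
  have hκa : LSeries.abscissaOfAbsConv κ ≤ 1 :=
    LSeries.abscissaOfAbsConv_le_of_le_const ⟨1, fun n _ => hκ n⟩
  have h1a : LSeries.abscissaOfAbsConv (1 : ℕ → ℂ) ≤ 1 :=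
    LSeries.abscissaOfAbsConv_le_of_le_const ⟨1, fun n _ => by simp⟩
  have hf2 : LSeriesSummable f 2 := by
    have := Literature.NumberTheory.LFunctions.LSeriesSummable_dedekindZeta (K := K) (s := 2) (by norm_num)
    exact this
  have hfa : LSeries.abscissaOfAbsConv f < ⊤ :=
    lt_of_le_of_lt hf2.abscissaOfAbsConv_le (by simp)
  have h2re : (1 : EReal) < ((2 : ℂ).re : EReal) := by
    have : (2 : ℂ).re = 2 := by simp
    rw [this]; exact_mod_cast one_lt_two
  have hκ2 : LSeriesSummable κ 2 := LSeriesSummable_of_abscissaOfAbsConv_lt_re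
    (lt_of_le_of_lt hκa h2re)
  have h12 : LSeriesSummable (1 : ℕ → ℂ) 2 := LSeriesSummable_of_abscissaOfAbsConv_lt_re
    (lt_of_le_of_lt h1a h2re)
  have hg2 : LSeriesSummable g 2 := h12.convolution hκ2
  have hga : LSeries.abscissaOfAbsConv g < ⊤ :=
    lt_of_le_of_lt hg2.abscissaOfAbsConv_le (by simp)
  -- `L(f, x) = L(g, x)` for real `x > 1`
  have hev : (fun x : ℝ => LSeries f x) =ᶠ[atTop] fun x => LSeries g x := by
    filter_upwards [eventually_gt_atTop (1 : ℝ)] with x hx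
    have hx' : 1 < (x : ℂ).re := by simpa using hx
    have h := hζ x hx'
    rw [Literature.NumberTheory.LFunctions.dedekindZeta_eq_LSeries] at h
    rw [hfdef, h, hgdef, ← LSeries_one_eq_riemannZeta hx',
      LSeries_convolution (lt_of_le_of_lt h1a (by exact_mod_cast hx)) (lt_of_le_of_lt hκa (by exact_mod_cast hx))]
  have h := LSeries.eq_of_LSeries_eventually_eq hfa hga hev hn
  change f n = _
  rw [h, hgdef, LSeries.convolution_def]
  simp only
  rw [Nat.sum_divisorsAntidiagonal' (fun k m => (1 : ℕ → ℂ) k * κ m)]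
  exact Finset.sum_congr rfl fun m _ => by simp


/-! ### Theta nulls and Hecke's Eisenstein series on `ℍ` -/

/-- `γ • τ = (aτ + b)/(cτ + d)` on `ℍ`, with the entries of `γ ∈ SL₂(ℤ)` cast from `ℤ` to `ℂ`. -/
theorem coe_sl_smul (γ : SL(2, ℤ)) (τ : ℍ) :
    ((γ • τ : ℍ) : ℂ) = (((γ 0 0 : ℤ) : ℂ) * (τ : ℂ) + ((γ 0 1 : ℤ) : ℂ)) /
      (((γ 1 0 : ℤ) : ℂ) * (τ : ℂ) + ((γ 1 1 : ℤ) : ℂ)) := by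
  rw [UpperHalfPlane.coe_specialLinearGroup_apply]
  simp

/-- **The weight-one law of an even binary theta null on `ℍ`** (`BinaryThetaNull`, restated on the
upper half-plane): for `B` even, symmetric, positive definite and `γ = (a b; c d) ∈ SL₂(ℤ)` with
`det B ∣ c` there is a unit `Λ` with `θ_B(γτ) = Λ (cτ + d) θ_B(τ)`, `θ_B(τ) = ϑ[0;0](0, τB)`. -/
theorem exists_unit_thetaNull_smul {B : Matrix (Fin 2) (Fin 2) ℤ} (hsymm : B.IsSymm)
    (h00 : Even (B 0 0)) (h11 : Even (B 1 1)) (hpos : (B.map (Int.cast : ℤ → ℝ)).PosDef)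
    {γ : SL(2, ℤ)} (hγ : B.det ∣ (γ 1 0 : ℤ)) :
    ∃ Λ : ℂ, ‖Λ‖ = 1 ∧ ∀ τ : ℍ,
      riemannThetaChar 0 0 (((γ • τ : ℍ) : ℂ) • B.map ((↑) : ℤ → ℂ)) 0 =
        Λ * (((γ 1 0 : ℤ) : ℂ) * (τ : ℂ) + ((γ 1 1 : ℤ) : ℂ)) *
          riemannThetaChar 0 0 ((τ : ℂ) • B.map ((↑) : ℤ → ℂ)) 0 := by
  obtain ⟨Λ, hΛ1, -, hΛ⟩ := exists_unit_riemannThetaChar_zero_transform hsymm h00 h11 hpos hγ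
  refine ⟨Λ, hΛ1, fun τ => ?_⟩
  rw [coe_sl_smul]
  exact riemannThetaChar_zero_smul_transform hΛ τ.im_pos

/-- **Hecke's weight-one Eisenstein series `G̃_κ(·,0)` on `Γ₀(D)`, pointwise**:
`G̃(γτ) = κ̄(d) (cτ + d) G̃(τ)` for `γ = (a b; c d)`, `D ∣ c` (`heckeOne_slash_of_mem_gamma0`). -/
theorem heckeOne_smul {D : ℕ} [NeZero D] (κ : DirichletCharacter ℂ D) (hodd : κ.Odd) {γ : SL(2, ℤ)}
    (hγ : (D : ℤ) ∣ (γ 1 0 : ℤ)) (τ : ℍ) :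
    heckeOne κ (γ • τ) = κ⁻¹ ((γ 1 1 : ℤ) : ZMod D) *
      (((γ 1 0 : ℤ) : ℂ) * (τ : ℂ) + ((γ 1 1 : ℤ) : ℂ)) * heckeOne κ τ := by
  have hmem : γ ∈ Gamma0 D := Gamma0_mem.mpr ((ZMod.intCast_zmod_eq_zero_iff_dvd _ D).mpr hγ)
  have h := congrFun (heckeOne_slash_of_mem_gamma0 κ hodd hmem) τ
  rw [ModularForm.SL_slash_apply, Pi.smul_apply, smul_eq_mul, ModularGroup.denom_apply]
    at h
  have hX : (((γ 1 0 : ℤ) : ℂ) * (τ : ℂ) + ((γ 1 1 : ℤ) : ℂ)) ≠ 0 := by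
    have := UpperHalfPlane.denom_ne_zero γ τ
    rwa [ModularGroup.denom_apply] at this
  calc heckeOne κ (γ • τ)
      = heckeOne κ (γ • τ) * (((γ 1 0 : ℤ) : ℂ) * (τ : ℂ) + ((γ 1 1 : ℤ) : ℂ)) ^ (-(1 : ℤ)) *
          (((γ 1 0 : ℤ) : ℂ) * (τ : ℂ) + ((γ 1 1 : ℤ) : ℂ)) := by
        rw [_root_.zpow_neg_one, inv_mul_cancel_right₀ hX]
    _ = _ := by rw [h]; ring

/-! ### The multiplier is the Kronecker character -/

/-- **The multiplier of an ideal-lattice theta null on `Γ₀(D)` is the Kronecker character**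
(Hecke 1926 §2; Schoeneberg 1939).  Let `K` be imaginary quadratic, `|d_K| ∣ D`, `κ` a primitive odd
Dirichlet character mod `D` with `κ² = 1` and `ζ_K(s) = ζ(s) L(s, κ)` for `Re s > 1`; let `𝔟 ≠ 0`
have Gram data `(b, B)` (`exists_gram`: `B_{ij} N𝔟 = Tr(σ(bᵢ) σ̄(bⱼ))`, symmetric, positive
definite); let `γ = (a b; c d) ∈ SL₂(ℤ)` with `D ∣ c` and `Λ ∈ ℂ` with
`θ_B(γτ) = Λ (cτ + d) θ_B(τ)` on `ℍ`.  Then `Λ = κ(d)`.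
Proof: apply `units_eq_of_thetaSum_eisenstein` to the theta nulls `θ_c` of Gram matrices of a system
`𝔞_c` of ideal-class representatives with `𝔞_{[𝔟]} = 𝔟` (`q`-expansions `hasSum_thetaNull_qExpansion`,
constant term `1`, limits `qSeries_norm_sub_one_lt`, laws `exists_unit_thetaNull_smul` for `γ` and
`γ₀ = (1 0; D 1)`) and `E = G̃_κ(·,0)` (`heckeOne_eq_qSeries`, `heckeOne_smul`; `e(0) = 2L(1,κ) ≠ 0`);
the coefficient identity `w e(n) = c₁ Σ_c r_c(n)` (`c₁ = -4πiτ(κ)/D`, `w = #𝓞_K^×`) is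
`sum_natCard_norm_eq` + `idealNormCount_eq_sum_divisors` + `κ̄ = κ`.  Finally `θ_B = θ_{[𝔟]}`
(same `q`-series) and `θ_B ≢ 0` give `Λ = Λ_{[𝔟]} = κ̄(d) = κ(d)`. -/
theorem binaryTheta_unit_eq_kronecker (hK : finrank ℚ K = 2) [IsTotallyComplex K] (σ : K →+* ℂ)
    {D : ℕ} [NeZero D] (hdvd : ((discr K).natAbs : ℤ) ∣ (D : ℤ)) {κ : DirichletCharacter ℂ D}
    (hprim : κ.IsPrimitive) (hodd : κ.Odd) (hquad : κ ^ 2 = 1)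
    (hζ : ∀ s : ℂ, 1 < s.re → NumberField.dedekindZeta K s = riemannZeta s * LSeries (fun n => κ n) s)
    {𝔟 : Ideal (𝓞 K)} (h𝔟 : 𝔟 ≠ ⊥) (b : Basis (Fin 2) ℤ 𝔟) {B : Matrix (Fin 2) (Fin 2) ℤ}
    (hB : ∀ i j, ((B i j : ℤ) : ℂ) * ((Ideal.absNorm 𝔟 : ℕ) : ℂ) =
      σ ((b i : 𝓞 K) : K) * conj (σ ((b j : 𝓞 K) : K)) + conj (σ ((b i : 𝓞 K) : K)) * σ ((b j : 𝓞 K) : K))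
    (hsymm : B.IsSymm) (hpos : (B.map (Int.cast : ℤ → ℝ)).PosDef)
    {γ : SL(2, ℤ)} (hγ : (D : ℤ) ∣ (γ 1 0 : ℤ)) {Λ : ℂ}
    (hΛ : ∀ τ : ℍ, riemannThetaChar 0 0 (((γ • τ : ℍ) : ℂ) • B.map ((↑) : ℤ → ℂ)) 0 =
      Λ * (((γ 1 0 : ℤ) : ℂ) * (τ : ℂ) + ((γ 1 1 : ℤ) : ℂ)) *
        riemannThetaChar 0 0 ((τ : ℂ) • B.map ((↑) : ℤ → ℂ)) 0) :
    Λ = κ ((γ 1 1 : ℤ) : ZMod D) := by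
  classical
  have hquad' : κ⁻¹ = κ := by rw [eq_comm, ← mul_eq_one_iff_eq_inv, ← pow_two, hquad]
  have hDpos : 0 < D := Nat.pos_of_ne_zero (NeZero.ne D)
  haveI : Finite (𝓞 K)ˣ := finite_units hK
  -- ideal-class representatives with `𝔞 c₀ = 𝔟`
  have h𝔟0 : 𝔟 ∈ (Ideal (𝓞 K))⁰ := mem_nonZeroDivisors_of_ne_zero h𝔟
  set c₀ : ClassGroup (𝓞 K) := ClassGroup.mk0 ⟨𝔟, h𝔟0⟩ with hc₀
  obtain ⟨𝔞, h𝔞, h𝔞𝔟⟩ : ∃ 𝔞 : ClassGroup (𝓞 K) → (Ideal (𝓞 K))⁰,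
      (∀ c, ClassGroup.mk0 (𝔞 c) = c) ∧ (𝔞 c₀ : Ideal (𝓞 K)) = 𝔟 := by
    refine ⟨Function.update (fun c => (ClassGroup.mk0_surjective c).choose) c₀ ⟨𝔟, h𝔟0⟩,
      fun c => ?_, by simp⟩
    rcases eq_or_ne c c₀ with rfl | hne
    · simp [hc₀]
    · rw [Function.update_of_ne hne]
      exact (ClassGroup.mk0_surjective c).choose_spec
  have h𝔞0 : ∀ c, (𝔞 c : Ideal (𝓞 K)) ≠ ⊥ := fun c => nonZeroDivisors.coe_ne_zero (𝔞 c)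
  -- Gram data of every class
  choose bc Bc hBc hsymmc h00c h11c hdetc hposc using fun c => exists_gram hK σ (h𝔞0 c)
  -- the auxiliary element `γ₀ = (1 0; D 1)`
  set γ₀ : SL(2, ℤ) := ⟨!![1, 0; (D : ℤ), 1], by simp [Matrix.det_fin_two_of]⟩ with hγ₀
  have hγ₀a : (γ₀ 0 0 : ℤ) = 1 := rfl
  have hγ₀b : (γ₀ 0 1 : ℤ) = 0 := rfl
  have hγ₀c : (γ₀ 1 0 : ℤ) = D := rfl
  have hγ₀d : (γ₀ 1 1 : ℤ) = 1 := rfl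
  have hdetγ : ∀ c, (Bc c).det ∣ (γ 1 0 : ℤ) := fun c => by rw [hdetc]; exact hdvd.trans hγ
  have hdetγ₀ : ∀ c, (Bc c).det ∣ (γ₀ 1 0 : ℤ) := fun c => by rw [hdetc, hγ₀c]; exact hdvd
  choose Λc hΛc1 hΛc using fun c => exists_unit_thetaNull_smul (hsymmc c) (h00c c) (h11c c) (hposc c) (hdetγ c)
  choose Λ0 _hΛ01 hΛ0 using fun c =>
    exists_unit_thetaNull_smul (hsymmc c) (h00c c) (h11c c) (hposc c) (hdetγ₀ c)
  -- the theta nulls, their `q`-expansions and limits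
  set θ : ClassGroup (𝓞 K) → ℍ → ℂ := fun c τ =>
    riemannThetaChar 0 0 ((τ : ℂ) • (Bc c).map ((↑) : ℤ → ℂ)) 0 with hθdef
  set a : ClassGroup (𝓞 K) → ℕ → ℕ := fun c n =>
    Nat.card {x : 𝓞 K // x ∈ (𝔞 c : Ideal (𝓞 K)) ∧
      Ideal.absNorm (Ideal.span {x}) = n * Ideal.absNorm (𝔞 c : Ideal (𝓞 K))} with hadef
  set r : ClassGroup (𝓞 K) → ℕ → ℂ := fun c n => (a c n : ℂ) with hrdef
  have hθ : ∀ c (τ : ℍ), HasSum (fun n : ℕ => r c n * cexp (2 * π * Complex.I * (τ : ℂ)) ^ n) (θ c τ) :=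
    fun c τ => hasSum_thetaNull_qExpansion hK σ (h𝔞0 c) (bc c) (hBc c) (hsymmc c) (hposc c) τ.im_pos
  have ha0 : ∀ c, a c 0 = 1 := fun c => natCard_norm_eq_zero _
  have hr0 : ∀ c, r c 0 = 1 := fun c => by simp only [hrdef, ha0, Nat.cast_one]
  have hlim : ∀ c, ∀ ε > 0, ∃ Y : ℝ, ∀ τ : ℍ, Y ≤ τ.im → ‖θ c τ - 1‖ < ε :=
    fun c => qSeries_norm_sub_one_lt (ha0 c) (hθ c)
  -- Hecke's Eisenstein series
  set E : ℍ → ℂ := fun τ => heckeOne κ τ with hEdef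
  set e : ℕ → ℂ := heckeOneCoeff κ with hedef
  have hE : ∀ τ : ℍ, HasSum (fun n : ℕ => e n * cexp (2 * π * Complex.I * (τ : ℂ)) ^ n) (E τ) := by
    intro τ
    show HasSum _ (heckeOne κ τ)
    rw [heckeOne_eq_qSeries κ hprim hodd τ]
    exact (summable_heckeOneCoeff_mul_pow κ τ).hasSum
  have hκ1 : κ ≠ 1 := Literature.NumberTheory.EllipticCurves.ModularForms.ne_one_of_odd κ hodd
  have he0 : e 0 ≠ 0 := by
    show heckeOneCoeff κ 0 ≠ 0
    rw [heckeOneCoeff, if_pos rfl]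
    exact mul_ne_zero two_ne_zero (DirichletCharacter.LFunction_apply_one_ne_zero hκ1)
  -- the coefficient identity `w e(n) = c₁ Σ_c r_c(n)`
  have hw : ((Nat.card (𝓞 K)ˣ : ℕ) : ℂ) ≠ 0 := by exact_mod_cast Nat.card_pos.ne'
  have hcoef : ∀ n : ℕ, n ≠ 0 → ((Nat.card (𝓞 K)ˣ : ℕ) : ℂ) * e n =
      -(4 * π * Complex.I * gaussSum κ (ZMod.stdAddChar (N := D)) / D) * ∑ c, r c n := by
    intro n hn
    have h1 : e n = -(4 * π * Complex.I * gaussSum κ (ZMod.stdAddChar (N := D)) / D) *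
        ∑ m ∈ n.divisors, κ m := by
      show heckeOneCoeff κ n = _
      rw [heckeOneCoeff, if_neg hn, hquad']
    have h2 : ∑ c, r c n = ((Nat.card (𝓞 K)ˣ : ℕ) : ℂ) * ∑ m ∈ n.divisors, κ m := by
      simp only [hrdef, hadef]
      rw [← Nat.cast_sum, sum_natCard_norm_eq hK 𝔞 h𝔞 hn, Nat.cast_mul,
        idealNormCount_eq_sum_divisors (κ := fun n => κ n) (fun m => κ.norm_le_one _) hζ hn]
    rw [h1, h2]; ring
  -- laws under `γ₀` and `γ`
  have hθ₀ : ∀ c (τ : ℍ), θ c (γ₀ • τ) = Λ0 c * ((D : ℂ) * τ + 1) * θ c τ := by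
    intro c τ
    have h := hΛ0 c τ
    rw [hγ₀c, hγ₀d] at h
    simpa only [Int.cast_natCast, Int.cast_one] using h
  have hE₀ : ∀ τ : ℍ, E (γ₀ • τ) = ((D : ℂ) * τ + 1) * E τ := by
    intro τ
    have h := heckeOne_smul κ hodd (γ := γ₀) (by rw [hγ₀c]) τ
    rw [hγ₀c, hγ₀d] at h
    simpa only [Int.cast_natCast, Int.cast_one, map_one, one_mul] using h
  -- `d` is a unit mod `D`, so `‖κ(d)‖ = 1`
  have hu : IsUnit ((γ 1 1 : ℤ) : ZMod D) := by
    have hdet := Matrix.SpecialLinearGroup.det_coe γ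
    rw [Matrix.det_fin_two] at hdet
    have hc : ((γ 1 0 : ℤ) : ZMod D) = 0 := (ZMod.intCast_zmod_eq_zero_iff_dvd _ D).mpr hγ
    have had : ((γ 0 0 : ℤ) : ZMod D) * ((γ 1 1 : ℤ) : ZMod D) = 1 := by
      have := congrArg (fun x : ℤ => (x : ZMod D)) hdet
      simp only [Int.cast_sub, Int.cast_mul, Int.cast_one, hc, mul_zero, sub_zero] at this
      exact this
    exact IsUnit.of_mul_eq_one _ (by rw [mul_comm]; exact had)
  have hχ1 : ‖κ ((γ 1 1 : ℤ) : ZMod D)‖ = 1 := by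
    obtain ⟨u, hu'⟩ := hu
    rw [← hu']
    exact κ.unit_norm_eq_one u
  have hEγ : ∀ τ : ℍ, E (γ • τ) = κ ((γ 1 1 : ℤ) : ZMod D) *
      (((γ 1 0 : ℤ) : ℂ) * τ + ((γ 1 1 : ℤ) : ℂ)) * E τ := by
    intro τ
    have h := heckeOne_smul κ hodd hγ τ
    rwa [hquad'] at h
  -- all class multipliers equal `κ(d)`
  have key := units_eq_of_thetaSum_eisenstein hθ hr0 hlim hE he0 hw hcoef hDpos hγ₀a hγ₀b hγ₀c hγ₀d
    hθ₀ hE₀ hΛc1 hχ1 hΛc hEγ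
  -- `θ_B = θ_{c₀}`
  have heq : ∀ τ : ℍ, riemannThetaChar 0 0 ((τ : ℂ) • B.map ((↑) : ℤ → ℂ)) 0 = θ c₀ τ := by
    intro τ
    have h1 := hasSum_thetaNull_qExpansion hK σ h𝔟 b hB hsymm hpos τ.im_pos
    have h2 := hθ c₀ τ
    simp only [hrdef, hadef] at h2
    rw [h𝔞𝔟] at h2
    exact h1.unique h2
  -- a point where `θ_{c₀}` does not vanish
  obtain ⟨Y, hY⟩ := hlim c₀ 1 one_pos
  set τ₁ : ℍ := UpperHalfPlane.mk ((max Y 1 : ℝ) * Complex.I) (by simp) with hτ₁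
  have hτ₁im : Y ≤ τ₁.im := by
    rw [hτ₁]; simp
  have hne : θ c₀ τ₁ ≠ 0 := by
    intro h0
    have := hY τ₁ hτ₁im
    rw [h0, zero_sub, norm_neg, norm_one] at this
    exact lt_irrefl _ this
  have hX : (((γ 1 0 : ℤ) : ℂ) * (τ₁ : ℂ) + ((γ 1 1 : ℤ) : ℂ)) ≠ 0 := by
    have := UpperHalfPlane.denom_ne_zero γ τ₁
    rwa [ModularGroup.denom_apply] at this
  have h1 := hΛ τ₁
  rw [heq, heq] at h1
  have h2 : θ c₀ (γ • τ₁) =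
      Λc c₀ * (((γ 1 0 : ℤ) : ℂ) * (τ₁ : ℂ) + ((γ 1 1 : ℤ) : ℂ)) * θ c₀ τ₁ := hΛc c₀ τ₁
  rw [h2] at h1
  have : Λ = Λc c₀ := (mul_right_cancel₀ hX (mul_right_cancel₀ hne h1)).symm
  rw [this, key c₀]

end Summit.BirchSwinnertonDyer.BirchSwinnertonDyer.Theorems.HeckeTheta

end
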